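import Literature.MathematicalPhysics.QuantumFieldTheory.BalabanImbrieJaffe1984to88.BIJ88TruncationConnected306
import Literature.Probability.LatticeModels.UrsellColourings
import Literature.Probability.LatticeModels.CumulantRecursion

/-!
# `Balaban1983to89.B3GaussianPerturbationGraphs` — T. Bałaban, *(Higgs)₂,₃ quantum fields in a finite volume. III.
# Renormalization*, Commun. Math. Phys. **88** (1983) 411–445 [Balaban1983Higgs3], p. 414 and p. 416: THE GRAPHS OF A
# GAUSSIAN PERTURBATION EXPANSION — the truncated Gaussian expectations of POLYNOMIAL vertices are the sums over the
# colourings of the vertices and over the CONNECTED Wick pairings of their legs, each pair of legs replaced by its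
# propagator (engine file; the (1.19) instance at `e = 0` is the sibling `B3Eq119ConnectedGraphs`)

statement-level skeleton of published theorems with citation tags; proofs where landed; nothing here is a claim about
the Yang–Mills mass gap

CITATION HEADER (lean-in-tree rule).  Part of the lit-balaban TYPED SKELETON (HOME `run/shared/lean/pub/lit-balaban/`),
Phase 2, proof seat p33 (gen 71, unit `lit-balaban-p33`); rows **B3.Eq1.17-1.18** (the graph notion, pp. 414–415) and
**B3.Eq1.19-1.22** ((1.21) p. 416, «graphs of the expansion of G^ε») of `HOME/lit-balaban-r15/ROWS-B3.md` (fold owner r15; both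
heads `proved`; this file is an OPTIONAL located ENGINE member, zero head weight: BRICK 5 of the target
`B3TwoPointPerturbativeExpansion` of the lead's HEAD WORD Q25 — «the Wick step at general order ↦ graph sums», r15 g15
2026-08-23T08:29:23Z).  USED BY NAME, nothing re-declared: p13's finite-dimensional Gaussian with source
(`B2Eq228Conditioning.weight/source`, `BIJ88TruncationConnected306.gexp` = the normalized expectation, `BIJ88WickSource305.cweight`,
**`wick_source_expect`** = Wick's theorem with source at every degree, `BIJ88TruncatedPair306.pair_vacuum`,
`BIJ88IntegrationByParts305.integrable_fieldProd_tilt`, `BIJ88SDerivative305.integral_weight_mul_source_pos`,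
`BIJ88PairingAllOrders5133.smallParts`); p13's combinatorics of record in `Literature/Probability/LatticeModels`:
**`LegDiagram.ursellOf_dmoment`** (Ursell functions of diagram moments = sums over CONNECTED diagrams), `LegDiagram.{legs, diags,
dval, dmoment, sum_diags, IsConn}`, **`UrsellColourings.ursellOf_piFinset`** (multilinearity of truncation in the clusters),
`ursellOf_map`, `eq_ursellOf_of_forall`, `sum_setPartitions_prod_ursellOf` (Ruelle's Möbius inversion `ursellOf`).

THE PRINT (pp. 414–416 = PDF 4–6 of the held text `paper:balaban1983-higgs-2-3-quantum-fields-finite-volume`; p. 414 re-read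
this session, p. 416 read in gen 70).  p. 414: «Now we can describe an arbitrary expression in the expansion. It consists of a
number of vertices. … All the A′-legs are contracted, i.e. they are divided into pairs and each pair is replaced by the
corresponding propagator. Some φ′-legs are replaced by external scalar fields and the remaining are again divided into pairs
and each pair is replaced by a propagator … Of course the whole expression is multiplied by a proper combinatorial factor
connected with the number of ways given expression can be obtained from Gaussian integrals in (1.5).»  p. 416: «The function
G^ε has a perturbative expansion … Σ^ε, Σ^ε_1, Σ^ε_2 are given by amputated, one-particle-irreducible graphs of the
expansion of G^ε. Here we have a graphical description of the same type as in (1.17) …».  The mathematical content of «the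
expansion of G^ε» into graphs — for a Gaussian unperturbed measure and polynomial vertices — is the classical statement
proved here [Mastropietro2008, §2.3 (2.38): «𝓔ᵀ(…) = Σ over all possible graphs obtained by contracting all the lines … with
the property that if the clusters were considered as points then G would be connected»; GlimmJaffe1987 §8.2–8.3]:
TRUNCATED expectations keep exactly the CONNECTED Wick pairings.

THE MODEL.  A finite index set `S` and a positive definite `A : Matrix S S ℝ`; the centred Gaussian `e^{−½⟨Φ,AΦ⟩}dΦ` on
`S → ℝ` with normalized expectation `⟨G⟩ = gexp A 0 G` (p13, source `ℱ = 0`), covariance `A⁻¹`.  Clusters `j : J` (`J`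
finite); each cluster is a POLYNOMIAL in linear legs written as a colour sum of monomials,
`X_j(Φ) = Σ_{c ∈ K_j} a_{j,c} · Π_{i < deg c} Φ(v_{c,i})` (`clusterVar`; colours `c : κ` carry a degree `deg c`, leg vectors
`lv c i : S → ℝ` and a coefficient `coef j c`): e.g. the vertex `−λΣ_yη^d|φ(y)|⁴` is the colour sum over `(y, a, b)` of the
monomials `φ_a(y)φ_a(y)φ_b(y)φ_b(y)` with coefficient `−λη^d`, and an observable `φ_a(x)φ_b(x′)` is a one-colour cluster of
degree 2.  Moments `pmoment P = ⟨Π_{j present in P} X_j⟩` on vertex families `P : Finset (Option J)` (the `LegDiagram` indexing;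
`none`, the slot of a leg-less observable, is not used), `jmoment Q = ⟨Π_{j∈Q} X_j⟩` on `Q : Finset J`.  For a colouring
`z : J → κ` the legs are `Leg deg z = Σ j, Fin (deg z_j)` owned by `Sigma.fst`, with vectors `legVec`, and the weight of a block
of legs is `pairW A v B = ⟨A⁻¹v_l, v_{l′}⟩` if `B = {l, l′}` is a pair, `0` otherwise.

WHAT IS PROVED (0 `sorry`, no `Prop` fact; standard axioms).
* §1 `ursellOf_prod_mul`: truncation is homogeneous of degree one in each vertex —
  `(P ↦ (Π_{x∈P}a_x)·m(P))ᵀ(V) = (Π_{x∈V}a_x)·mᵀ(V)` (uniqueness of the Möbius inversion; `prod_prod_of_isSetPartition`).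
* §2 `present`, `prod_present_eq` (bookkeeping between `Finset J` and `Finset (Option J)`).
* §3 `gexp_zero_source`, `gexp_sum_mul` (linearity over finite sums of integrable terms), `gexp_two_legs`
  (`⟨Φ(w)Φ(w′)⟩ = ⟨A⁻¹w, w′⟩`, p13's `pair_vacuum` at `ℱ = 0`).
* §4 `pairW_pair` / `pairW_of_card_ne_two` (pairs ↦ propagators, other blocks ↦ 0), `sum_setPartitions_prod_pairW` (= p13's
  small-partition contraction sum at `ℱ = 0`), `prod_present_legProd` (the monomials of a colouring as a product over its legs),
  **`cmoment_eq_dmoment`** (Wick's theorem for the monomials of one colouring in `LegDiagram` form: `m_z = dmoment pairW`),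
  `prod_present_clusterVar_eq_sum` / **`pmoment_eq_sum`** (`m(P) = Σ_z (Π_j a_{j,z_j}) m_z(P)`, colourings free on the clusters
  present — `Fintype.piFinset (colours K z₀ P)`), and the headline **`ursellOf_pmoment`** / `ursellOf_pmoment_of_not_mem`:
  `⟨X_{j₁}; …; X_{j_k}⟩ᵀ = Σ_z (Π_j a_{j,z_j}) · Σ_{τ CONNECTED pairing of the legs of z} Π_{{l,l′}∈τ} ⟨A⁻¹v_l, v_{l′}⟩`
  (`ursellOf_piFinset` → `ursellOf_prod_mul` → `ursellOf_dmoment`); `fst_eq_empty_of_mem_diags` (without observable a diagram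
  is a set partition of all the legs).
* §5 `jmoment_eq_pmoment`, `piFinset_colours_univ`, **`ursellOf_jmoment_univ`**: the truncated expectation of ALL the clusters
  `⟨X_j ; j ∈ J⟩ᵀ = Σ_{z ∈ Π_j K_j} (Π_j a_{j,z_j}) · Σ_{connected pairings} Π ⟨A⁻¹v_l, v_{l′}⟩` — the sum over the connected
  Feynman graphs (vertices = clusters, lines = propagators `A⁻¹`) of Gaussian perturbation theory.
HONEST SCOPE.  (i) Finite dimension, real fields, centred Gaussian given by a positive definite precision matrix (the lattice
free fields of [B3] at `e = 0` are of this kind — sibling file); (ii) «divided into pairs»: blocks of a set partition that are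
not pairs get weight `0` (`pairW`), so only perfect matchings of the legs contribute, and an odd number of legs gives `0`
term by term; (iii) «connected» is `LegDiagram.IsConn` (no proper vertex subfamily is closed under the pairing); the
symmetry/«combinatorial factor» bookkeeping of print (counting graphs up to isomorphism) is NOT performed — the sum runs over
labelled pairings; (iv) no external fields other than what a cluster's legs encode, no 1PI notion, no estimates.
-/

noncomputable section

open MeasureTheory Matrix Finset
open scoped BigOperators

namespace Literature.MathematicalPhysics.QuantumFieldTheory.Balaban1983to89.B3GaussianPerturbationGraphs

open Literature.Probability.LatticeModels (ursellOf setPartitions IsSetPartition mem_setPartitions colours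
  mem_piFinset_colours ursellOf_piFinset eq_ursellOf_of_forall sum_setPartitions_prod_ursellOf ursellOf_map)
open Literature.Probability.LatticeModels.LegDiagram (legs mem_legs diags mem_diags dval dmoment sum_diags IsConn
  IsDiag ursellOf_dmoment)
open Literature.MathematicalPhysics.QuantumFieldTheory.BalabanImbrieJaffe1984to88
open B2Eq228Conditioning (weight source)
open BIJ88PairingAllOrders5133 (smallParts mem_smallParts)
open BIJ88WickSource305 (cweight cweight_pair wick_source_expect)
open BIJ88TruncationConnected306 (gexp)
open BIJ88TruncatedPair306 (pair_vacuum)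
open BIJ88IntegrationByParts305 (integrable_fieldProd_tilt weight_mul_source)
open BIJ88SDerivative305 (integral_weight_mul_source_pos)

/-! ## §1 Truncation is homogeneous under vertex-wise rescaling -/

section Scaling

variable {α : Type*} [DecidableEq α] {R : Type*} [CommRing R]

/-- Over a set partition `π` of `V`, `∏_{P ∈ π} ∏_{x ∈ P} a(x) = ∏_{x ∈ V} a(x)`. [folklore]
[cite: Mastropietro2008, §2.3 (2.32)-(2.36)] -/
theorem prod_prod_of_isSetPartition (a : α → R) {V : Finset α} {π : Finset (Finset α)} (hπ : IsSetPartition V π) :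
    ∏ P ∈ π, ∏ x ∈ P, a x = ∏ x ∈ V, a x := by
  have h := prod_biUnion (s := π) (t := id) (f := a) hπ.pairwiseDisjoint
  rw [hπ.biUnion_id] at h
  rw [h]
  rfl

/-- **Truncation is homogeneous of degree one in each vertex**: rescaling every vertex `x` by a factor `a(x)`,
`m′(P) = (∏_{x∈P} a(x))·m(P)`, rescales the truncated function by the same product,
`m′ᵀ(V) = (∏_{x∈V} a(x))·mᵀ(V)` (multilinearity of `𝓔ᵀ`). [cite: Mastropietro2008, §2.3 (2.32)-(2.36)] -/
theorem ursellOf_prod_mul (a : α → R) (m : Finset α → R) {V : Finset α} (hV : V.Nonempty) :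
    ursellOf (fun P => (∏ x ∈ P, a x) * m P) V = (∏ x ∈ V, a x) * ursellOf m V := by
  symm
  refine eq_ursellOf_of_forall (fun P => (∏ x ∈ P, a x) * m P) (fun P => (∏ x ∈ P, a x) * ursellOf m P) ?_ hV
  intro W hW
  calc ∑ π ∈ setPartitions W, ∏ P ∈ π, ((∏ x ∈ P, a x) * ursellOf m P)
      = ∑ π ∈ setPartitions W, (∏ x ∈ W, a x) * ∏ P ∈ π, ursellOf m P := by
        refine sum_congr rfl fun π hπ => ?_
        rw [prod_mul_distrib, prod_prod_of_isSetPartition a (mem_setPartitions.1 hπ)]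
    _ = (∏ x ∈ W, a x) * m W := by rw [← mul_sum, sum_setPartitions_prod_ursellOf m hW]

end Scaling

/-! ## §2 Vertex families in the `LegDiagram` convention: the clusters present in `P ⊆ Option J` -/

section Present

variable {J : Type*} [Fintype J] [DecidableEq J]

/-- The clusters `j` with `some j ∈ P` (the convention of `LegDiagram`: vertices are indexed by `Option J`, `none` being
reserved for an observable without legs — absent in this file). [cite: Mastropietro2008, §2.3 (2.38)] -/
def present (P : Finset (Option J)) : Finset J := univ.filter fun j => some j ∈ P

/-- [cite: Mastropietro2008, §2.3 (2.38)] -/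
@[simp] theorem mem_present {P : Finset (Option J)} {j : J} : j ∈ present P ↔ some j ∈ P := by
  simp [present]

/-- `present (W.map some) = W`. [cite: Mastropietro2008, §2.3 (2.38)] -/
theorem present_map_some (W : Finset J) : present (W.map Function.Embedding.some) = W := by
  ext j
  simp [present]

/-- A product over the present clusters is a product over `P` with the value `1` at `none`.
[cite: Mastropietro2008, §2.3 (2.38)] -/
theorem prod_present_eq {R : Type*} [CommMonoid R] (f : J → R) (P : Finset (Option J)) :
    ∏ j ∈ present P, f j = ∏ x ∈ P, x.elim 1 f := by
  have h1 : ∏ x ∈ P, x.elim 1 f = ∏ x ∈ P.filter (fun x => x ≠ none), x.elim 1 f := by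
    refine (prod_filter_of_ne fun x _ hx => ?_).symm
    cases x with
    | none => exact absurd rfl hx
    | some j => exact Option.some_ne_none j
  have h2 : P.filter (fun x => x ≠ none) = (present P).map Function.Embedding.some := by
    ext x
    constructor
    · intro hx
      obtain ⟨hxP, hne⟩ := mem_filter.1 hx
      obtain ⟨j, rfl⟩ := Option.ne_none_iff_exists'.1 hne
      exact mem_map.2 ⟨j, mem_present.2 hxP, rfl⟩
    · intro hx
      obtain ⟨j, hj, rfl⟩ := mem_map.1 hx
      exact mem_filter.2 ⟨mem_present.1 hj, Option.some_ne_none j⟩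
  rw [h1, h2, prod_map]
  rfl

end Present

/-! ## §3 The normalized Gaussian expectation without source -/

section Gaussian

variable {S : Type} [Fintype S]

/-- At source `ℱ = 0` the source factor is `1`. [cite: BalabanImbrieJaffe1988, §5.13 p.305] -/
theorem source_zero (φ : S → ℝ) : source (0 : S → ℝ) φ = 1 := by
  simp [B2Eq228Conditioning.source]

/-- The normalized expectation of the centred Gaussian `e^{−½⟨Φ,AΦ⟩}dΦ`: `⟨G⟩ = ∫ G e^{−½⟨Φ,AΦ⟩} / ∫ e^{−½⟨Φ,AΦ⟩}`.
[cite: BalabanImbrieJaffe1988, §5.13 p.305] -/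
theorem gexp_zero_source (A : Matrix S S ℝ) (G : (S → ℝ) → ℝ) :
    gexp A 0 G = (∫ φ : S → ℝ, G φ * weight A φ) / ∫ φ : S → ℝ, weight A φ := by
  simp [gexp, source_zero]

/-- Linearity of the normalized expectation over finite sums of integrable terms. [cite: BalabanImbrieJaffe1988, §5.13 p.305] -/
theorem gexp_sum_mul (A : Matrix S S ℝ) (f : S → ℝ) {ι : Type*} (s : Finset ι) (c : ι → ℝ)
    (G : ι → (S → ℝ) → ℝ) (hG : ∀ i ∈ s, Integrable fun φ : S → ℝ => G i φ * (weight A φ * source f φ)) :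
    gexp A f (fun φ => ∑ i ∈ s, c i * G i φ) = ∑ i ∈ s, c i * gexp A f (G i) := by
  unfold gexp
  simp_rw [← mul_div_assoc, ← sum_div]
  congr 1
  have h : (fun φ : S → ℝ => (∑ i ∈ s, c i * G i φ) * (weight A φ * source f φ))
      = fun φ => ∑ i ∈ s, c i * (G i φ * (weight A φ * source f φ)) := by
    funext φ
    rw [sum_mul]
    exact sum_congr rfl fun i _ => mul_assoc _ _ _
  rw [h, integral_finsetSum _ fun i hi => (hG i hi).const_mul (c i)]
  exact sum_congr rfl fun i _ => integral_const_mul _ _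

/-- **Two legs**: `⟨Φ(w)Φ(w′)⟩ = ⟨A⁻¹w, w′⟩` — the propagator of a pair is the covariance (p13's `pair_vacuum` at
`ℱ = 0`). [cite: Balaban1983Higgs3, p.414] [cite: BalabanImbrieJaffe1988, §5.13 p.306] -/
theorem gexp_two_legs [DecidableEq S] {A : Matrix S S ℝ} (hA : A.PosDef) (w w' : S → ℝ) :
    gexp A 0 (fun φ => (φ ⬝ᵥ w) * (φ ⬝ᵥ w')) = (A⁻¹ *ᵥ w) ⬝ᵥ w' := by
  have hZ := (integral_weight_mul_source_pos hA (0 : S → ℝ)).ne'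
  rw [gexp, pair_vacuum A hA 0 w w', dotProduct_zero, zero_mul, add_zero, mul_div_assoc, div_self hZ, mul_one]

end Gaussian

/-! ## §4 Polynomial clusters: colour sums of monomials in linear legs -/

section Clusters

variable {S : Type} [Fintype S] [DecidableEq S]
variable {J : Type} [Fintype J] [DecidableEq J] {κ : Type*}
variable (A : Matrix S S ℝ) (K : J → Finset κ) (coef : J → κ → ℝ) (deg : κ → ℕ) (lv : κ → ℕ → S → ℝ)

/-- One monomial of colour `c`: the product of its `deg c` legs `Φ(v_{c,i})`, `i < deg c`.
[cite: Balaban1983Higgs3, p.414] -/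
def legProd (c : κ) (φ : S → ℝ) : ℝ := ∏ i : Fin (deg c), φ ⬝ᵥ lv c i

/-- The cluster variable of the cluster `j`: a colour sum of monomials, `X_j = Σ_{c ∈ K_j} a_{j,c} Π_{i<deg c} Φ(v_{c,i})`
(a vertex of the expansion, summed over its position, its internal indices and its types). [cite: Balaban1983Higgs3, p.414] -/
def clusterVar (j : J) (φ : S → ℝ) : ℝ := ∑ c ∈ K j, coef j c * legProd deg lv c φ

/-- The moments of the cluster variables: `m(P) = ⟨Π_{j present in P} X_j⟩` in the centred Gaussian `e^{−½⟨Φ,AΦ⟩}dΦ`.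
[cite: Balaban1983Higgs3, p.414] -/
def pmoment (P : Finset (Option J)) : ℝ := gexp A 0 fun φ => ∏ j ∈ present P, clusterVar K coef deg lv j φ

/-- The product of the coefficients of a colouring over the present clusters. [cite: Balaban1983Higgs3, p.414] -/
def coefProd (z : J → κ) (P : Finset (Option J)) : ℝ := ∏ j ∈ present P, coef j (z j)

/-- The moments of the monomials of ONE colouring: `m_z(P) = ⟨Π_{j present in P} Π_{i<deg z_j} Φ(v_{z_j,i})⟩`.
[cite: Balaban1983Higgs3, p.414] -/
def cmoment (z : J → κ) (P : Finset (Option J)) : ℝ := gexp A 0 fun φ => ∏ j ∈ present P, legProd deg lv (z j) φ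

/-- The legs of a colouring `z`: cluster `j` owns the legs `(j, i)`, `i < deg z_j`. [cite: Balaban1983Higgs3, p.414] -/
abbrev Leg (z : J → κ) : Type := Σ j : J, Fin (deg (z j))

/-- The leg vectors of a colouring. [cite: Balaban1983Higgs3, p.414] -/
def legVec (z : J → κ) (l : Leg deg z) : S → ℝ := lv (z l.1) l.2

/-- Weight of the (vacuous) observable legs: only `D = ∅` counts (there is no observable in this file).
[cite: Mastropietro2008, §2.3 (2.38)] -/
def obsW {Λ : Type*} [DecidableEq Λ] (D : Finset Λ) : ℝ := if D = ∅ then 1 else 0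

/-- **The propagator of a pair of legs**: `w_{{l,l′}} = ⟨A⁻¹v_l, v_{l′}⟩`, and `0` on blocks that are not pairs (Wick).
[cite: Balaban1983Higgs3, p.414] -/
def pairW {Λ : Type} [DecidableEq Λ] (v : Λ → S → ℝ) (B : Finset Λ) : ℝ :=
  if B.card = 2 then cweight A 0 v B else 0

variable {A K coef deg lv}

/-- The pair weight of a pair is the propagator `⟨A⁻¹v_l, v_{l′}⟩` («each pair is replaced by the corresponding
propagator»). [cite: Balaban1983Higgs3, p.414] -/
theorem pairW_pair (hA : A.PosDef) {Λ : Type} [DecidableEq Λ] (v : Λ → S → ℝ) {l l' : Λ} (h : l ≠ l') :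
    pairW A v {l, l'} = (A⁻¹ *ᵥ v l) ⬝ᵥ v l' := by
  rw [pairW, if_pos (card_pair h), cweight_pair hA 0 v h]

/-- Blocks that are not pairs carry weight `0`. [cite: Balaban1983Higgs3, p.414] -/
theorem pairW_of_card_ne_two {Λ : Type} [DecidableEq Λ] (v : Λ → S → ℝ) {B : Finset Λ} (h : B.card ≠ 2) :
    pairW A v B = 0 := if_neg h

/-- At zero source the contraction weights of the blocks of size `≤ 2` are the pair weights (singletons contract to
`ℱ = 0`). [cite: BalabanImbrieJaffe1988, §5.13 p.305] -/
theorem pairW_eq_of_card_le_two {Λ : Type} [DecidableEq Λ] (v : Λ → S → ℝ) {B : Finset Λ} (h : B.card ≤ 2) :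
    pairW A v B = cweight A 0 v B := by
  unfold pairW
  split_ifs with h2
  · rfl
  · unfold cweight
    split_ifs with h1
    · symm
      exact sum_eq_zero fun i _ => dotProduct_zero _
    · have hB : B = ∅ := card_eq_zero.1 (by omega)
      subst hB
      simp

/-- Summing the pair weights over all set partitions of a leg set is summing p13's contraction weights over its
partitions into blocks of size `≤ 2`. [cite: BalabanImbrieJaffe1988, §5.13 p.305] -/
theorem sum_setPartitions_prod_pairW {Λ : Type} [DecidableEq Λ] (v : Λ → S → ℝ) (T : Finset Λ) :
    ∑ τ ∈ setPartitions T, ∏ B ∈ τ, pairW A v B = ∑ σ ∈ smallParts T, ∏ B ∈ σ, cweight A 0 v B := by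
  rw [smallParts, sum_filter]
  refine sum_congr rfl fun τ _ => ?_
  split_ifs with h
  · exact prod_congr rfl fun B hB => pairW_eq_of_card_le_two v (h B hB)
  · simp only [not_forall, not_le, exists_prop] at h
    obtain ⟨B, hB, hBc⟩ := h
    exact prod_eq_zero hB (pairW_of_card_ne_two v (by omega))

/-- The legs of the clusters present in `P` are the pairs `(j, i)`, `some j ∈ P`, `i < deg z_j`.
[cite: Balaban1983Higgs3, p.414] -/
theorem legs_eq_sigma (z : J → κ) (P : Finset (Option J)) :
    legs (Sigma.fst : Leg deg z → J) P = (present P).sigma fun j => (univ : Finset (Fin (deg (z j)))) := by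
  ext ⟨j, i⟩
  simp [present]

omit [DecidableEq S] in
/-- The product of the monomials of a colouring is the product of its legs. [cite: Balaban1983Higgs3, p.414] -/
theorem prod_present_legProd (z : J → κ) (P : Finset (Option J)) (φ : S → ℝ) :
    ∏ j ∈ present P, legProd deg lv (z j) φ = ∏ l ∈ legs (Sigma.fst : Leg deg z → J) P, φ ⬝ᵥ legVec deg lv z l := by
  rw [legs_eq_sigma, prod_sigma]
  rfl

/-- The monomials of a colouring are integrable against the Gaussian weight. [cite: BalabanImbrieJaffe1988, §5.13 p.305] -/
theorem integrable_prod_legProd (hA : A.PosDef) (z : J → κ) (P : Finset (Option J)) :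
    Integrable fun φ : S → ℝ => (∏ j ∈ present P, legProd deg lv (z j) φ) * (weight A φ * source 0 φ) := by
  refine (integrable_fieldProd_tilt hA (legs (Sigma.fst : Leg deg z → J) P) (legVec deg lv z) 0).congr
    (ae_of_all _ fun φ => ?_)
  dsimp only
  rw [prod_present_legProd, weight_mul_source]

/-- **Wick's theorem for the monomials of a colouring, in diagram form**: `m_z(P)` is the diagram moment of
`LegDiagram` with the pair weights (every leg divided into pairs, each pair replaced by its propagator; no
observable). [cite: Balaban1983Higgs3, p.414] -/
theorem cmoment_eq_dmoment (hA : A.PosDef) (z : J → κ) (P : Finset (Option J)) :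
    cmoment A deg lv z P = dmoment (Sigma.fst : Leg deg z → J) (pairW A (legVec deg lv z)) obsW P := by
  have hL : cmoment A deg lv z P
      = ∑ τ ∈ setPartitions (legs (Sigma.fst : Leg deg z → J) P), ∏ B ∈ τ, pairW A (legVec deg lv z) B := by
    have h1 : (fun φ : S → ℝ => ∏ j ∈ present P, legProd deg lv (z j) φ)
        = fun φ => ∏ l ∈ legs (Sigma.fst : Leg deg z → J) P, φ ⬝ᵥ legVec deg lv z l :=
      funext fun φ => prod_present_legProd z P φ
    rw [cmoment, h1, gexp, wick_source_expect A hA 0 (legVec deg lv z) _, sum_setPartitions_prod_pairW]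
  rw [hL, dmoment, sum_diags]
  symm
  have h0 : (∅ : Finset (Leg deg z)) ∈ (legs (Sigma.fst : Leg deg z → J) P).powerset.filter
      (fun D => D.Nonempty → none ∈ P) :=
    mem_filter.2 ⟨empty_mem_powerset _, fun h => absurd h not_nonempty_empty⟩
  rw [sum_eq_single_of_mem ∅ h0 fun D hD hne => ?_]
  · rw [sdiff_empty]
    refine sum_congr rfl fun τ _ => ?_
    rw [dval, obsW, if_pos rfl, ite_self, mul_one]
  · refine sum_eq_zero fun τ _ => ?_
    by_cases hn : none ∈ P
    · rw [dval, if_pos hn, obsW, if_neg hne, mul_zero]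
    · exact absurd ((mem_filter.1 hD).2 (nonempty_iff_ne_empty.2 hne)) hn

omit [DecidableEq S] in
/-- Expanding the product of the cluster variables over the colourings: `Π_{j∈P} X_j = Σ_z (Π_j a_{j,z_j}) Π_j Π_i Φ(v_{z_j,i})`.
[cite: Balaban1983Higgs3, p.414] -/
theorem prod_present_clusterVar_eq_sum (z₀ : J → κ) (P : Finset (Option J)) (φ : S → ℝ) :
    ∏ j ∈ present P, clusterVar K coef deg lv j φ
      = ∑ z ∈ Fintype.piFinset (colours K z₀ P),
          coefProd coef z P * ∏ j ∈ present P, legProd deg lv (z j) φ := by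
  have h1 : ∏ j ∈ present P, clusterVar K coef deg lv j φ
      = ∏ j, ∑ c ∈ colours K z₀ P j, (if some j ∈ P then coef j c * legProd deg lv c φ else 1) := by
    rw [present, prod_filter]
    refine prod_congr rfl fun j _ => ?_
    unfold colours
    split_ifs with hj
    · rfl
    · rw [sum_singleton]
  rw [h1, prod_univ_sum]
  refine sum_congr rfl fun z _ => ?_
  rw [coefProd, ← prod_mul_distrib, present, prod_filter]

/-- **The moments are colour sums**: `m(P) = Σ_{z} (Π_{j∈P} a_{j,z_j}) · m_z(P)`, the colourings `z` free over `K_j` on the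
clusters present and frozen at `z₀` elsewhere. [cite: Balaban1983Higgs3, p.414] -/
theorem pmoment_eq_sum (hA : A.PosDef) (z₀ : J → κ) (P : Finset (Option J)) :
    pmoment A K coef deg lv P
      = ∑ z ∈ Fintype.piFinset (colours K z₀ P), coefProd coef z P * cmoment A deg lv z P := by
  have h : (fun φ : S → ℝ => ∏ j ∈ present P, clusterVar K coef deg lv j φ)
      = fun φ => ∑ z ∈ Fintype.piFinset (colours K z₀ P),
          coefProd coef z P * ∏ j ∈ present P, legProd deg lv (z j) φ :=
    funext fun φ => prod_present_clusterVar_eq_sum z₀ P φ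
  unfold pmoment cmoment
  rw [h, gexp_sum_mul]
  exact fun z _ => integrable_prod_legProd hA z P

/-- **TRUNCATED GAUSSIAN EXPECTATIONS OF POLYNOMIAL VERTICES ARE SUMS OVER COLOURINGS AND CONNECTED PAIRINGS**: for the
centred Gaussian `e^{−½⟨Φ,AΦ⟩}dΦ` (`A` positive definite) and clusters `X_j = Σ_{c∈K_j} a_{j,c}Π_{i<deg c}Φ(v_{c,i})`, for
every nonempty vertex family `V`,
`⟨X_{j₁}; …; X_{j_k}⟩ᵀ = Σ_{z} (Π_j a_{j,z_j}) · Σ_{(D,τ) connected diagram on the legs of z} (Π_{B∈τ} w_B)·ω_D`,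
`w` the pair weights (`pairW`: pairs ↦ propagators, other blocks ↦ 0), `ω_D = [D = ∅]` — «they are divided into pairs and
each pair is replaced by a propagator … multiplied by a proper combinatorial factor connected with the number of ways
given expression can be obtained from Gaussian integrals», the vacuum (disconnected) parts removed by the truncation.
[cite: Balaban1983Higgs3, p.414] [cite: Mastropietro2008, §2.3 (2.38)] -/
theorem ursellOf_pmoment (hA : A.PosDef) (z₀ : J → κ) {V : Finset (Option J)} (hV : V.Nonempty) :
    ursellOf (pmoment A K coef deg lv) V
      = ∑ z ∈ Fintype.piFinset (colours K z₀ V), coefProd coef z V *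
          ∑ g ∈ (diags (Sigma.fst : Leg deg z → J) V).filter (IsConn (Sigma.fst : Leg deg z → J) V),
            dval (pairW A (legVec deg lv z)) obsW V g := by
  rw [ursellOf_piFinset K z₀ (pmoment A K coef deg lv) (fun z P => coefProd coef z P * cmoment A deg lv z P)
    ?_ (fun P => pmoment_eq_sum hA z₀ P) hV]
  · refine sum_congr rfl fun z _ => ?_
    have h1 : (fun P => coefProd coef z P * cmoment A deg lv z P)
        = fun P => (∏ x ∈ P, x.elim 1 fun j => coef j (z j))
            * dmoment (Sigma.fst : Leg deg z → J) (pairW A (legVec deg lv z)) obsW P := by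
      funext P
      rw [coefProd, prod_present_eq, cmoment_eq_dmoment hA]
    rw [h1, ursellOf_prod_mul _ _ hV, ← prod_present_eq, ursellOf_dmoment _ _ hV]
    rfl
  · intro P z z' h
    have hc : coefProd coef z P = coefProd coef z' P :=
      prod_congr rfl fun j hj => by rw [h j (mem_present.1 hj)]
    have hm : cmoment A deg lv z P = cmoment A deg lv z' P := by
      unfold cmoment
      congr 1
      funext φ
      exact prod_congr rfl fun j hj => by rw [h j (mem_present.1 hj)]
    rw [hc, hm]

/-- The same without observable weight: for `none ∉ V` every diagram is a set partition of the legs and its value is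
the product of the pair weights, so
`⟨X_{j₁}; …; X_{j_k}⟩ᵀ = Σ_z (Π_j a_{j,z_j}) Σ_{τ connected pairing of the legs of z} Π_{{l,l′}∈τ} ⟨A⁻¹v_l, v_{l′}⟩`.
[cite: Balaban1983Higgs3, p.414] [cite: Mastropietro2008, §2.3 (2.38)] -/
theorem ursellOf_pmoment_of_not_mem (hA : A.PosDef) (z₀ : J → κ) {V : Finset (Option J)} (hV : V.Nonempty)
    (hn : none ∉ V) :
    ursellOf (pmoment A K coef deg lv) V
      = ∑ z ∈ Fintype.piFinset (colours K z₀ V), coefProd coef z V *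
          ∑ g ∈ (diags (Sigma.fst : Leg deg z → J) V).filter (IsConn (Sigma.fst : Leg deg z → J) V),
            ∏ B ∈ g.2, pairW A (legVec deg lv z) B := by
  rw [ursellOf_pmoment hA z₀ hV]
  refine sum_congr rfl fun z _ => ?_
  congr 1
  refine sum_congr rfl fun g _ => ?_
  rw [dval, if_neg hn, mul_one]

/-- For `none ∉ V` the connected diagrams have no observable legs: `g.1 = ∅` and `g.2` is a set partition of all the
legs of `V`; only PAIRINGS contribute (other blocks have weight `0`). [cite: Mastropietro2008, §2.3 (2.38)] -/
theorem fst_eq_empty_of_mem_diags {z : J → κ} {V : Finset (Option J)} (hn : none ∉ V)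
    {g : Finset (Leg deg z) × Finset (Finset (Leg deg z))} (hg : g ∈ diags (Sigma.fst : Leg deg z → J) V) :
    g.1 = ∅ ∧ IsSetPartition (legs (Sigma.fst : Leg deg z → J) V) g.2 := by
  obtain ⟨h1, h2, h3⟩ := (mem_diags _).1 hg
  have he : g.1 = ∅ := not_nonempty_iff_eq_empty.1 fun hne => hn (h2 hne)
  refine ⟨he, ?_⟩
  rwa [he, sdiff_empty] at h3

end Clusters

/-! ## §5 The vertex family indexed by `J` itself (all clusters present) -/

section AllPresent

variable {S : Type} [Fintype S] [DecidableEq S]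
variable {J : Type} [Fintype J] [DecidableEq J] {κ : Type*}
variable (A : Matrix S S ℝ) (K : J → Finset κ) (coef : J → κ → ℝ) (deg : κ → ℕ) (lv : κ → ℕ → S → ℝ)

/-- The moments indexed by subsets of `J`: `Q ↦ ⟨Π_{j∈Q} X_j⟩`. [cite: Balaban1983Higgs3, p.414] -/
def jmoment (Q : Finset J) : ℝ := gexp A 0 fun φ => ∏ j ∈ Q, clusterVar K coef deg lv j φ

variable {A K coef deg lv}

omit [DecidableEq S] in
/-- `jmoment Q = pmoment (Q.map some)`. [cite: Balaban1983Higgs3, p.414] -/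
theorem jmoment_eq_pmoment (Q : Finset J) :
    jmoment A K coef deg lv Q = pmoment A K coef deg lv (Q.map Function.Embedding.some) := by
  rw [jmoment, pmoment, present_map_some]

/-- With every cluster present the colourings range over all of `Π_j K_j`. [cite: Mastropietro2008, §2.3 (2.32)-(2.36)] -/
theorem piFinset_colours_univ (z₀ : J → κ) :
    Fintype.piFinset (colours K z₀ ((univ : Finset J).map Function.Embedding.some)) = Fintype.piFinset K := by
  congr 1
  funext j
  rw [colours, if_pos (by simp)]

/-- **THE TRUNCATED EXPECTATION OF ALL THE CLUSTERS** `⟨X_{j}; j ∈ J⟩ᵀ` (e.g. one observable cluster and `n` vertices):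
`= Σ_{z ∈ Π_j K_j} (Π_j a_{j,z_j}) · Σ_{τ connected pairing of the legs (j,i), i<deg z_j} Π_{{l,l′}∈τ} ⟨A⁻¹v_l, v_{l′}⟩` —
the sum over the CONNECTED Feynman graphs of the Gaussian perturbation expansion (vertices = clusters, lines =
propagators). [cite: Balaban1983Higgs3, p.414, (1.21) p.416] [cite: Mastropietro2008, §2.3 (2.38)] -/
theorem ursellOf_jmoment_univ [Nonempty J] (hA : A.PosDef) (z₀ : J → κ) :
    ursellOf (jmoment A K coef deg lv) univ
      = ∑ z ∈ Fintype.piFinset K, (∏ j, coef j (z j)) *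
          ∑ g ∈ (diags (Sigma.fst : Leg deg z → J) ((univ : Finset J).map Function.Embedding.some)).filter
              (IsConn (Sigma.fst : Leg deg z → J) ((univ : Finset J).map Function.Embedding.some)),
            ∏ B ∈ g.2, pairW A (legVec deg lv z) B := by
  obtain ⟨j₀⟩ := ‹Nonempty J›
  have hfun : jmoment A K coef deg lv = fun Q => pmoment A K coef deg lv (Q.map Function.Embedding.some) :=
    funext fun Q => jmoment_eq_pmoment Q
  have hV : ((univ : Finset J).map Function.Embedding.some).Nonempty := ⟨some j₀, mem_map_of_mem _ (mem_univ j₀)⟩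
  have hn : none ∉ (univ : Finset J).map Function.Embedding.some := by simp
  rw [hfun, ursellOf_map, ursellOf_pmoment_of_not_mem hA z₀ hV hn, piFinset_colours_univ]
  refine sum_congr rfl fun z _ => ?_
  rw [coefProd, present_map_some]

end AllPresent

end Literature.MathematicalPhysics.QuantumFieldTheory.Balaban1983to89.B3GaussianPerturbationGraphs
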